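import Literature.NumberTheory.Automorphic.RestrictedTensorProduct
import HarnessLib

/-!
# Rank bound for quotients of (finite) restricted tensor products

Topic `NumberTheory/Automorphic`. Pure linear algebra used in the reduction of local multiplicity
one to supercuspidal representations (Bernstein–Zelevinsky 1977, §4.7, the step
`(⊗_a ρ_a)_{U_M,θ} ≅ ⊗_a (ρ_a)_{U_a,θ_a}`, in the weak form of an upper bound).

Let `ι` be finite, `j : RestrictedFamily V x₀ → W` restricted-multilinear
(`IsRestrictedMultilinear`, `RestrictedTensorProduct`), `N i ≤ V i` and `M ≤ W` submodules such
that each slot map `y ↦ j (x.update i y)` sends `N i` into `M` (`hN`), and suppose every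
quotient `V i ⧸ N i` has rank `≤ 1`, i.e. `V i = k e_i + N i` (`he`). Then:

* `mkQ_apply_mem_span_singleton` — every `j x` is a multiple of `j e` modulo `M`;
* `rank_quotient_le_one_of_span_range_eq_top` — if moreover the values of `j` span `W`, then
  `Module.rank k (W ⧸ M) ≤ 1`.

(Slot by slot: `x_i ≡ r_i e_i (mod N i)` and linearity of `j` in the `i`-th slot.) Theorems and
one definition with body (`IsRestrictedMultilinear.slot`, `RestrictedFamily.ofFun`); no named fact.

## References

* I. N. Bernstein, A. V. Zelevinsky, *Induced representations of reductive `p`-adic groups I*,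
  Ann. Sci. ÉNS 10 (1977), §4.7. [BernsteinZelevinskyASENS1977]
-/

open scoped RestrictedProduct
open Filter

namespace Literature.NumberTheory.Automorphic

section Bound

variable {ι : Type*} {k : Type*} [CommRing k] {V : ι → Type*} [∀ i, AddCommGroup (V i)]
  [∀ i, Module k (V i)] {x₀ : ∀ i, V i} {W : Type*} [AddCommGroup W] [Module k W]
  [DecidableEq ι] {j : RestrictedFamily V x₀ → W}

/-- The `i`-th **slot map** `y ↦ j (x.update i y)` of a restricted-multilinear map, as a linear
map. [folklore] -/
def IsRestrictedMultilinear.slot (hj : IsRestrictedMultilinear k j) (x : RestrictedFamily V x₀) (i : ι) :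
    V i →ₗ[k] W where
  toFun y := j (x.update i y)
  map_add' := hj.map_update_add x i
  map_smul' := hj.map_update_smul x i

/-- Unfolding lemma for `slot`. [folklore] -/
@[simp] lemma IsRestrictedMultilinear.slot_apply (hj : IsRestrictedMultilinear k j)
    (x : RestrictedFamily V x₀) (i : ι) (y : V i) : hj.slot x i y = j (x.update i y) := rfl

omit [∀ i, AddCommGroup (V i)] in
/-- Updating a coordinate with its own value does nothing (a copy of the lemma of
`AutomorphicGLnFlathProofs`, kept private to avoid the heavy import). [folklore] -/
private lemma RestrictedFamily.update_eq_self' (x : RestrictedFamily V x₀) (i : ι) :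
    x.update i (x i) = x := by
  ext i'
  simp

variable [Finite ι]

/-- Over a finite index type every family is a restricted family. [folklore] -/
def RestrictedFamily.ofFun (v : ∀ i, V i) : RestrictedFamily V x₀ :=
  RestrictedProduct.mk v (Filter.eventually_cofinite.2 (Set.toFinite _))

omit [DecidableEq ι] [∀ i, AddCommGroup (V i)] in
/-- Coordinates of `ofFun`. [folklore] -/
@[simp] lemma RestrictedFamily.ofFun_apply (v : ∀ i, V i) (i : ι) :
    (RestrictedFamily.ofFun (x₀ := x₀) v) i = v i := rfl

/-- **Slot-by-slot reduction.** If each slot map sends `N i` into `M` and `V i = k e_i + N i`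
for all `i`, then modulo `M` every value `j x` is a multiple of `j e`. [folklore] -/
theorem mkQ_apply_mem_span_singleton (hj : IsRestrictedMultilinear k j)
    (N : ∀ i, Submodule k (V i)) (M : Submodule k W)
    (hN : ∀ (x : RestrictedFamily V x₀) (i : ι), N i ≤ M.comap (hj.slot x i))
    (e : ∀ i, V i) (he : ∀ (i : ι) (v : V i), ∃ r : k, v - r • e i ∈ N i)
    (x : RestrictedFamily V x₀) :
    M.mkQ (j x) ∈ k ∙ M.mkQ (j (RestrictedFamily.ofFun e)) := by
  classical
  -- induction on the finite set of coordinates where `x` may differ from `e`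
  suffices h : ∀ (S : Finset ι) (x : RestrictedFamily V x₀), (∀ i ∉ S, x i = e i) →
      M.mkQ (j x) ∈ k ∙ M.mkQ (j (RestrictedFamily.ofFun e)) by
    cases nonempty_fintype ι
    exact h Finset.univ x fun i hi => absurd (Finset.mem_univ i) hi
  intro S
  induction S using Finset.induction_on with
  | empty =>
    intro x hx
    have : x = RestrictedFamily.ofFun e := by
      ext i'
      exact hx i' (Finset.notMem_empty i')
    rw [this]
    exact Submodule.mem_span_singleton_self _
  | insert i S hiS ih =>
    intro x hx
    obtain ⟨r, hr⟩ := he i (x i)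
    -- `x' = x` with the `i`-th coordinate replaced by `e i`
    have hx' : ∀ i' ∉ S, (x.update i (e i)) i' = e i' := by
      intro i' hi'
      by_cases h : i' = i
      · subst h
        simp
      · rw [RestrictedFamily.update_apply, Function.update_of_ne h]
        exact hx i' (by simp [h, hi'])
    have hdecomp : M.mkQ (j x) = r • M.mkQ (j (x.update i (e i))) := by
      have h1 : j x = hj.slot x i (x i) := by simp [RestrictedFamily.update_eq_self']
      have h2 : hj.slot x i (x i) = r • hj.slot x i (e i) + hj.slot x i (x i - r • e i) := by
        rw [← map_smul, ← map_add, add_sub_cancel]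
      have h3 : M.mkQ (hj.slot x i (x i - r • e i)) = 0 := by
        rw [Submodule.mkQ_apply, Submodule.Quotient.mk_eq_zero]
        exact hN x i hr
      rw [h1, h2, map_add, h3, add_zero, map_smul, hj.slot_apply]
    rw [hdecomp]
    exact Submodule.smul_mem _ _ (ih _ hx')

/-- **Rank bound.** Under the hypotheses of `mkQ_apply_mem_span_singleton`, if the values of `j`
span `W` then `W ⧸ M` has rank `≤ 1`. (The weak form of
`(⊗_i V_i) ⧸ ⟨slots⟩ ≅ ⊗_i (V_i ⧸ N_i)` with one-dimensional factors.) [folklore] -/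
theorem rank_quotient_le_one_of_span_range_eq_top {k : Type*} [Field k] [∀ i, Module k (V i)] [Module k W]
    {j : RestrictedFamily V x₀ → W} (hj : IsRestrictedMultilinear k j)
    (N : ∀ i, Submodule k (V i)) (M : Submodule k W)
    (hN : ∀ (x : RestrictedFamily V x₀) (i : ι), N i ≤ M.comap (hj.slot x i))
    (e : ∀ i, V i) (he : ∀ (i : ι) (v : V i), ∃ r : k, v - r • e i ∈ N i)
    (hspan : Submodule.span k (Set.range j) = ⊤) :
    Module.rank k (W ⧸ M) ≤ 1 := by
  rw [rank_le_one_iff]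
  refine ⟨M.mkQ (j (RestrictedFamily.ofFun e)), fun q => ?_⟩
  obtain ⟨w, rfl⟩ := Submodule.mkQ_surjective M q
  have hw : w ∈ Submodule.span k (Set.range j) := hspan ▸ Submodule.mem_top
  have hle : Submodule.span k (Set.range j) ≤ (k ∙ M.mkQ (j (RestrictedFamily.ofFun e))).comap M.mkQ := by
    rw [Submodule.span_le]
    rintro _ ⟨x, rfl⟩
    exact mkQ_apply_mem_span_singleton hj N M hN e he x
  exact Submodule.mem_span_singleton.1 (hle hw)

end Bound

end Literature.NumberTheory.Automorphic
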